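import Literature.Computability.MetaComplexity.FregeVerifierModel
import Literature.Computability.Complexity.ProofComplexityProofs
import Literature.Computability.Complexity.StackLists
import HarnessLib

/-!
# A string-level verifier for `textbookFrege` proofs, II: completeness of the model

Continuation of `FregeVerifierModel.lean` (towards
`Literature.Computability.Complexity.textbookFrege_hasPolyTimeVerifier`, Cook–Reckhow 1979,
closing remark of §1). Here we prove that every `textbookFrege`-proof `π` of a formula `φ`
yields a certificate (a list of items) on which the model checker `FregeVerifier.run` ends with
verdict `true` and last line `φ.code`, and whose bit length in the certificate format of the
machine (`certBits`) is polynomial in `proofSize π + |code φ|`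
(`FregeVerifier.exists_certificate`).

## The printed argument and what is added

Cook–Reckhow (§1, pp. 39–40) write a proof as the string of its lines. Our certificate is that
string made redundant enough to be checked by string comparisons alone: before the item
applying a rule to produce line `B_k = σ_k D` (rule `(C₁, …, C_m)/D`, Def. 2.1 loc. cit.) we
insert *pool items* certifying, bottom-up, the codes of all subformulas of `B_k`
(`poolItems`, one item per node), so that the substituted formulas `σ_k P` (`P = A, B, C`),
which are subformulas of `B_k` or of the premise lines `σ_k C_j` (earlier lines), are found in
the pool. Two normalisations precede this: (1) by Lemma 2.5 (loc. cit.; in the tree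
`FregeSystem.IsProofOf.map_subst`) the variables of `π` not occurring in `φ` are replaced by
`⊤`, which keeps `π` a proof of `φ`, does not increase sizes, and bounds every variable index
by `|code φ|` (`exists_normalized`); (2) metavariables of a rule not occurring in it are sent to
`⊤` (its code `011` is put into the pool by the first item; the checker requires all three
payloads of a rule item to be certified). The length bound is then bookkeeping: a line of size
`m` contributes `m` pool items and one rule item, each of `O((|code φ| + 1) · proofSize π)`
bits (`certBits_poolItems_le`, `good_succ`, `lineBits_le`, `exists_good`).

## References

* S. A. Cook, R. A. Reckhow, *The relative efficiency of propositional proof systems*,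
  J. Symbolic Logic 44 (1979) 36–50: §1 (closing remark), §2 Def. 2.1, Lemma 2.5.
-/

namespace Literature.Computability.MetaComplexity

open _root_.Computability Complexity

namespace FregeVerifier

/-! ### The certificate format -/

/-- An item of a certificate: kind tag and three payload strings. [folklore] -/
abbrev Item := List Bool × List Bool × List Bool × List Bool

/-- The string of an item: the record `⟨kind, ⟨a, ⟨b, ⟨c, ε⟩⟩⟩⟩`. [folklore] -/
def enc4 (it : Item) : List Bool :=
  boolPair it.1 (boolPair it.2.1 (boolPair it.2.2.1 (boolPair it.2.2.2 [])))

/-- The certificate string of a list of items: the tree's right-nested list code `encList`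
(`StackLists.lean`: `[e₁, e₂, …] ↦ ⟨e₁, ⟨e₂, … ⟨e_k, ε⟩…⟩⟩`) of the item strings. [folklore] -/
def cert (items : List Item) : List Bool := encList (items.map enc4)

/-- The bit length of an item inside a certificate: `2 |enc4 it| + 2`. [folklore] -/
def itemBits (it : Item) : ℕ :=
  2 * (2 * (it.1.length + it.2.1.length + it.2.2.1.length + it.2.2.2.length) + 8) + 2

/-- The bit length of a certificate, item by item. [folklore] -/
def certBits (items : List Item) : ℕ := (items.map itemBits).sum

/-- Length of an item string. [folklore] -/
theorem length_enc4 (it : Item) :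
    (enc4 it).length = 2 * (it.1.length + it.2.1.length + it.2.2.1.length + it.2.2.2.length) + 8 := by
  simp [enc4, length_boolPair]; ring

/-- The certificate string has length `certBits`. [folklore] -/
theorem length_cert (items : List Item) : (cert items).length = certBits items := by
  simp only [cert, certBits, length_encList, List.map_map]
  congr 1
  refine List.map_congr_left fun it _ => ?_
  simp [Function.comp, itemBits, length_enc4]

/-- `certBits` is additive. [folklore] -/
theorem certBits_append (is js : List Item) : certBits (is ++ js) = certBits is + certBits js := by
  simp [certBits, List.map_append, List.sum_append]

/-- `certBits` of no items. [folklore] -/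
@[simp] theorem certBits_nil : certBits [] = 0 := rfl

/-- `certBits` of a singleton. [folklore] -/
@[simp] theorem certBits_singleton (it : Item) : certBits [it] = itemBits it := by simp [certBits]

/-- `certBits` of a cons. [folklore] -/
@[simp] theorem certBits_cons (it : Item) (is : List Item) : certBits (it :: is) = itemBits it + certBits is := by
  simp [certBits]

/-! ### Subformulas and pool items -/

universe u in
/-- The list of subformula occurrences of a formula, root first. [folklore] -/
def subs {ν : Type u} : PropForm ν → List (PropForm ν)
  | .var x => [.var x]
  | .const b => [.const b]
  | .neg θ => .neg θ :: subs θ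
  | .conj θ ψ => .conj θ ψ :: (subs θ ++ subs ψ)
  | .disj θ ψ => .disj θ ψ :: (subs θ ++ subs ψ)

section Subs

universe u v
variable {ν : Type u} {μ : Type v}

/-- A formula is a subformula of itself. [folklore] -/
theorem self_mem_subs (θ : PropForm ν) : θ ∈ subs θ := by
  cases θ <;> simp [subs]

/-- Subformulas are no larger. [folklore] -/
theorem size_le_of_mem_subs {θ sub : PropForm ν} (h : sub ∈ subs θ) : sub.size ≤ θ.size := by
  induction θ with
  | var x => simp [subs] at h; subst h; rfl
  | const b => simp [subs] at h; subst h; rfl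
  | neg θ ih =>
    simp only [subs, List.mem_cons] at h
    rcases h with rfl | h
    · rfl
    · have := ih h; simp [PropForm.size]; omega
  | conj θ ψ ih₁ ih₂ =>
    simp only [subs, List.mem_cons, List.mem_append] at h
    rcases h with rfl | h | h
    · rfl
    · have := ih₁ h; simp [PropForm.size]; omega
    · have := ih₂ h; simp [PropForm.size]; omega
  | disj θ ψ ih₁ ih₂ =>
    simp only [subs, List.mem_cons, List.mem_append] at h
    rcases h with rfl | h | h
    · rfl
    · have := ih₁ h; simp [PropForm.size]; omega
    · have := ih₂ h; simp [PropForm.size]; omega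

/-- Variables of subformulas are variables of the formula. [folklore] -/
theorem varList_subset_of_mem_subs {θ sub : PropForm ν} (h : sub ∈ subs θ) {v : ν}
    (hv : v ∈ sub.varList) : v ∈ θ.varList := by
  induction θ with
  | var x => simp [subs] at h; subst h; exact hv
  | const b => simp [subs] at h; subst h; exact hv
  | neg θ ih =>
    simp only [subs, List.mem_cons] at h
    rcases h with rfl | h
    · exact hv
    · simpa [PropForm.varList] using ih h
  | conj θ ψ ih₁ ih₂ =>
    simp only [subs, List.mem_cons, List.mem_append] at h
    rcases h with rfl | h | h
    · exact hv
    · simp [PropForm.varList, ih₁ h]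
    · simp [PropForm.varList, ih₂ h]
  | disj θ ψ ih₁ ih₂ =>
    simp only [subs, List.mem_cons, List.mem_append] at h
    rcases h with rfl | h | h
    · exact hv
    · simp [PropForm.varList, ih₁ h]
    · simp [PropForm.varList, ih₂ h]

/-- Subformulas commute with relabelling. [folklore] -/
theorem subs_mapVars (f : ν → μ) (θ : PropForm ν) :
    subs (θ.mapVars f) = (subs θ).map (PropForm.mapVars f) := by
  induction θ <;> simp_all [subs, PropForm.mapVars]

/-- The value of a substitution at a variable of `T` is a subformula of the instance `Tσ`.
[folklore] -/
theorem apply_mem_subs_subst (σ : ν → PropForm ν) {T : PropForm ν} {j : ν} (hj : j ∈ T.varList) :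
    σ j ∈ subs (T.subst σ) := by
  induction T with
  | var x => simp [PropForm.varList] at hj; subst hj; exact self_mem_subs _
  | const b => simp [PropForm.varList] at hj
  | neg T ih => simpa [PropForm.varList, PropForm.subst, subs] using Or.inr (ih hj)
  | conj T U ih₁ ih₂ =>
    simp only [PropForm.varList, List.mem_append] at hj
    simp only [PropForm.subst, subs, List.mem_cons, List.mem_append]
    rcases hj with hj | hj
    · exact Or.inr (Or.inl (ih₁ hj))
    · exact Or.inr (Or.inr (ih₂ hj))
  | disj T U ih₁ ih₂ =>
    simp only [PropForm.varList, List.mem_append] at hj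
    simp only [PropForm.subst, subs, List.mem_cons, List.mem_append]
    rcases hj with hj | hj
    · exact Or.inr (Or.inl (ih₁ hj))
    · exact Or.inr (Or.inr (ih₂ hj))

end Subs

/-- The pool items certifying the codes of all subformulas of `θ`, children before parents.
[folklore] -/
def poolItems : PropForm (List Bool) → List Item
  | .var bs => [(tag 0, bs, [], [])]
  | .const true => [(tag 1, [], [], [])]
  | .const false => [(tag 2, [], [], [])]
  | .neg θ => poolItems θ ++ [(tag 3, scode θ, [], [])]
  | .conj θ ψ => poolItems θ ++ poolItems ψ ++ [(tag 4, scode θ, scode ψ, [])]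
  | .disj θ ψ => poolItems θ ++ poolItems ψ ++ [(tag 5, scode θ, scode ψ, [])]

/-- The strings the pool items of `θ` add to the pool (most recent first). [folklore] -/
def extra : PropForm (List Bool) → List (List Bool)
  | .var bs => [scode (.var bs)]
  | .const b => [scode (.const b)]
  | .neg θ => scode (.neg θ) :: extra θ
  | .conj θ ψ => scode (.conj θ ψ) :: (extra ψ ++ extra θ)
  | .disj θ ψ => scode (.disj θ ψ) :: (extra ψ ++ extra θ)

/-- The code of `θ` heads `extra θ`. [folklore] -/
theorem scode_mem_extra (θ : PropForm (List Bool)) : scode θ ∈ extra θ := by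
  cases θ <;> simp [extra]

/-- Codes of all subformulas are in `extra`. [folklore] -/
theorem scode_mem_extra_of_mem_subs {θ sub : PropForm (List Bool)} (h : sub ∈ subs θ) :
    scode sub ∈ extra θ := by
  induction θ with
  | var x => simp [subs] at h; subst h; simp [extra]
  | const b => simp [subs] at h; subst h; simp [extra]
  | neg θ ih =>
    simp only [subs, List.mem_cons] at h
    rcases h with rfl | h
    · exact scode_mem_extra _
    · exact List.mem_cons_of_mem _ (ih h)
  | conj θ ψ ih₁ ih₂ =>
    simp only [subs, List.mem_cons, List.mem_append] at h
    rcases h with rfl | h | h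
    · exact scode_mem_extra _
    · exact List.mem_cons_of_mem _ (List.mem_append_right _ (ih₁ h))
    · exact List.mem_cons_of_mem _ (List.mem_append_left _ (ih₂ h))
  | disj θ ψ ih₁ ih₂ =>
    simp only [subs, List.mem_cons, List.mem_append] at h
    rcases h with rfl | h | h
    · exact scode_mem_extra _
    · exact List.mem_cons_of_mem _ (List.mem_append_right _ (ih₁ h))
    · exact List.mem_cons_of_mem _ (List.mem_append_left _ (ih₂ h))

/-- A pool item of kind `n < 6` acts by `applyKind`. [folklore] -/
theorem stepModel_tag {n : ℕ} (hn : n < numKinds) (a b c : List Bool) (st : MState) :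
    stepModel (tag n) a b c st = applyKind n a b c st := by
  simp [stepModel, kindOf_tag hn]

/-- **Running the pool items of `θ`** certifies exactly the codes `extra θ`, without failing.
[folklore] -/
theorem run_poolItems (θ : PropForm (List Bool)) (st : MState) :
    run (poolItems θ) st = ⟨st.ok, st.lines, extra θ ++ st.pool⟩ := by
  induction θ generalizing st with
  | var bs =>
    obtain ⟨ok, lines, pool⟩ := st
    simp [poolItems, run, stepModel_tag (show 0 < numKinds by decide), applyKind, poolOk, poolOut,
      extra, scode]
  | const b =>
    obtain ⟨ok, lines, pool⟩ := st
    cases b <;>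
      simp [poolItems, run, stepModel_tag (show 1 < numKinds by decide),
        stepModel_tag (show 2 < numKinds by decide), applyKind, poolOk, poolOut, extra, scode]
  | neg θ ih =>
    obtain ⟨ok, lines, pool⟩ := st
    rw [poolItems, run_append, ih]
    simp [run, stepModel_tag (show 3 < numKinds by decide), applyKind, poolOk, poolOut, extra,
      scode, scode_mem_extra]
  | conj θ ψ ih₁ ih₂ =>
    obtain ⟨ok, lines, pool⟩ := st
    rw [poolItems, run_append, run_append, ih₁, ih₂]
    simp [run, stepModel_tag (show 4 < numKinds by decide), applyKind, poolOk, poolOut, extra,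
      scode, scode_mem_extra]
  | disj θ ψ ih₁ ih₂ =>
    obtain ⟨ok, lines, pool⟩ := st
    rw [poolItems, run_append, run_append, ih₁, ih₂]
    simp [run, stepModel_tag (show 5 < numKinds by decide), applyKind, poolOk, poolOut, extra,
      scode, scode_mem_extra]

/-- Bit length of the pool items of `θ`: `θ.size` items, each with payloads among the codes of
subformulas of `θ`. [folklore] -/
theorem certBits_poolItems_le {B : ℕ} (θ : PropForm (List Bool)) (hB : ∀ bs ∈ θ.varList, bs.length ≤ B) :
    certBits (poolItems θ) ≤ θ.size * (8 * (2 * B + 4) * θ.size + 42) := by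
  -- every item has tag of length ≤ 6 and payloads of total length ≤ 2 (2B+4) |θ|
  have key : ∀ (θ : PropForm (List Bool)), (∀ bs ∈ θ.varList, bs.length ≤ B) →
      ∀ it ∈ poolItems θ, itemBits it ≤ 8 * (2 * B + 4) * θ.size + 42 := by
    intro θ
    induction θ with
    | var bs =>
      intro hB it hit
      simp only [poolItems, List.mem_singleton] at hit
      subst hit
      have := hB bs (by simp [PropForm.varList])
      simp [itemBits, tag, PropForm.size]
      nlinarith
    | const b =>
      intro hB it hit
      cases b <;> simp only [poolItems, List.mem_singleton] at hit <;> subst hit <;>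
        simp [itemBits, tag, PropForm.size]
    | neg θ ih =>
      intro hB it hit
      have hBθ : ∀ bs ∈ θ.varList, bs.length ≤ B := fun bs h => hB bs (by simpa [PropForm.varList] using h)
      simp only [poolItems, List.mem_append, List.mem_singleton] at hit
      rcases hit with hit | rfl
      · have := ih hBθ it hit
        simp only [PropForm.size]; nlinarith
      · have := length_scode_le θ hBθ
        simp only [itemBits, tag, List.length_replicate, List.length_nil, PropForm.size]
        nlinarith
    | conj θ ψ ih₁ ih₂ =>
      intro hB it hit
      have hBθ : ∀ bs ∈ θ.varList, bs.length ≤ B := fun bs h => hB bs (by simp [PropForm.varList, h])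
      have hBψ : ∀ bs ∈ ψ.varList, bs.length ≤ B := fun bs h => hB bs (by simp [PropForm.varList, h])
      simp only [poolItems, List.mem_append, List.mem_singleton] at hit
      rcases hit with (hit | hit) | rfl
      · have := ih₁ hBθ it hit
        simp only [PropForm.size]; nlinarith
      · have := ih₂ hBψ it hit
        simp only [PropForm.size]; nlinarith
      · have h₁ := length_scode_le θ hBθ
        have h₂ := length_scode_le ψ hBψ
        simp only [itemBits, tag, List.length_replicate, List.length_nil, PropForm.size]
        nlinarith
    | disj θ ψ ih₁ ih₂ =>
      intro hB it hit
      have hBθ : ∀ bs ∈ θ.varList, bs.length ≤ B := fun bs h => hB bs (by simp [PropForm.varList, h])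
      have hBψ : ∀ bs ∈ ψ.varList, bs.length ≤ B := fun bs h => hB bs (by simp [PropForm.varList, h])
      simp only [poolItems, List.mem_append, List.mem_singleton] at hit
      rcases hit with (hit | hit) | rfl
      · have := ih₁ hBθ it hit
        simp only [PropForm.size]; nlinarith
      · have := ih₂ hBψ it hit
        simp only [PropForm.size]; nlinarith
      · have h₁ := length_scode_le θ hBθ
        have h₂ := length_scode_le ψ hBψ
        simp only [itemBits, tag, List.length_replicate, List.length_nil, PropForm.size]
        nlinarith
  have hlen : ∀ θ : PropForm (List Bool), (poolItems θ).length = θ.size := by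
    intro θ
    induction θ with
    | var _ => rfl
    | const b => cases b <;> rfl
    | neg θ ih => simp [poolItems, PropForm.size, ih]
    | conj θ ψ ih₁ ih₂ => simp [poolItems, PropForm.size, ih₁, ih₂]; omega
    | disj θ ψ ih₁ ih₂ => simp [poolItems, PropForm.size, ih₁, ih₂]; omega
  calc certBits (poolItems θ) = ((poolItems θ).map itemBits).sum := rfl
    _ ≤ ((poolItems θ).map fun _ => 8 * (2 * B + 4) * θ.size + 42).sum :=
        List.sum_le_sum (fun it hit => key θ hB it hit)
    _ = θ.size * (8 * (2 * B + 4) * θ.size + 42) := by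
        rw [List.map_const', List.sum_replicate, hlen, smul_eq_mul]

/-! ### Rule items -/

/-- All metavariables of a rule (conclusion and premises, with multiplicity). [folklore] -/
def allVars (r : FregeRule) : List ℕ := (r.conclusion :: r.premises).flatMap PropForm.varList

/-- `substL` depends only on the values at the variables of the template. [folklore] -/
theorem substL_congr {θ θ' : ℕ → PropForm (List Bool)} (T : PropForm ℕ)
    (h : ∀ j ∈ T.varList, θ j = θ' j) : substL θ T = substL θ' T := by
  induction T with
  | var i => simpa [substL, PropForm.varList] using h
  | const b => rfl
  | neg T ih => simp [substL, ih (fun j hj => h j (by simpa [PropForm.varList] using hj))]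
  | conj T U ih₁ ih₂ =>
    simp [substL, ih₁ (fun j hj => h j (by simp [PropForm.varList, hj])),
      ih₂ (fun j hj => h j (by simp [PropForm.varList, hj]))]
  | disj T U ih₁ ih₂ =>
    simp [substL, ih₁ (fun j hj => h j (by simp [PropForm.varList, hj])),
      ih₂ (fun j hj => h j (by simp [PropForm.varList, hj]))]

/-- A rule item of kind `6 + i` applies rule `i`. [folklore] -/
theorem stepModel_rule {i : ℕ} (hi : i < textbookFrege.rules.length) (a b c : List Bool) (st : MState) :
    stepModel (tag (6 + i)) a b c st =
      ⟨st.ok && ruleOk textbookFrege.rules[i] (sv a b c) st.lines st.pool,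
        sfill (sv a b c) textbookFrege.rules[i].conclusion :: st.lines, st.pool⟩ := by
  rw [length_rules] at hi
  rw [stepModel_tag (show 6 + i < numKinds by unfold numKinds; omega)]
  unfold applyKind
  rw [if_neg (by omega), Nat.add_sub_cancel_left, List.getElem?_eq_getElem (by simp; omega)]

/-- The three payload strings read back by `sv`. [folklore] -/
theorem sv_lt_three (a b c : List Bool) {j : ℕ} (hj : j < 3) (s : ℕ → List Bool)
    (h0 : s 0 = a) (h1 : s 1 = b) (h2 : s 2 = c) : sv a b c j = s j := by
  match j, hj with
  | 0, _ => exact h0.symm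
  | 1, _ => exact h1.symm
  | 2, _ => exact h2.symm

/-- Length of the code of (the relabelling of) a formula of size `≤ S` whose variable indices
have binary length `≤ B`. [folklore] -/
theorem length_scode_mapVars_le {B S : ℕ} {χ : PropForm ℕ} (hsize : χ.size ≤ S)
    (hv : ∀ v ∈ χ.varList, (encodeNat v).length ≤ B) :
    (scode (χ.mapVars encodeNat)).length ≤ (2 * B + 4) * S := by
  refine (length_scode_le (B := B) (χ.mapVars encodeNat) fun bs hbs => ?_).trans ?_
  · rw [PropForm.varList_mapVars] at hbs
    obtain ⟨v, hv', rfl⟩ := List.mem_map.1 hbs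
    exact hv v hv'
  · rw [PropForm.size_mapVars]
    exact Nat.mul_le_mul_left _ hsize

/-! ### The main invariant and the induction over the lines of the proof -/

/-- The code of the binary relabelling of a line. [folklore] -/
def lcode (ψ : PropForm ℕ) : List Bool := scode (ψ.mapVars encodeNat)

/-- The invariant after the items of the first `k` lines of `π`: no failure, the lines derived
are the codes of `π[0..k)` (most recent first), the code of `⊤` and the codes of all
subformulas of these lines are in the pool. [folklore] -/
structure Good (π : List (PropForm ℕ)) (k : ℕ) (st : MState) : Prop where
  /-- no check failed -/
  ok : st.ok = true
  /-- the derived lines -/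
  lines : st.lines = ((π.take k).map lcode).reverse
  /-- `⊤` is certified -/
  ctrue : [false, true, true] ∈ st.pool
  /-- all subformulas of the processed lines are certified -/
  subs : ∀ (m : ℕ) (hm : m < π.length), m < k →
    ∀ sub ∈ subs (π[m].mapVars encodeNat), scode sub ∈ st.pool

/-- **One more line.** Given the invariant for `k` lines of a `textbookFrege`-derivation `π`
(from no hypotheses) whose variable indices have binary length `≤ B`, the pool items of line
`k` followed by its rule item re-establish the invariant for `k + 1` lines, at a cost of at most
`ψ.size · (8 (2B+4) S + 42) + 12 (2B+4) (S+1) + 78` bits (`S = proofSize π`).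
[cite: CookReckhow1979, §2 Def. 2.1 (derivations) and Lemma 2.5] -/
theorem good_succ {π : List (PropForm ℕ)} (hπ : textbookFrege.IsDerivation ∅ π) {B : ℕ}
    (hB : ∀ ψ ∈ π, ∀ v ∈ ψ.varList, (encodeNat v).length ≤ B) {k : ℕ} (hk : k < π.length)
    {st : MState} (hst : Good π k st) :
    ∃ its : List Item, Good π (k + 1) (run its st) ∧
      certBits its ≤ π[k].size * (8 * (2 * B + 4) * proofSize π + 42) +
        (12 * (2 * B + 4) * (proofSize π + 1) + 78) := by
  obtain ⟨hok, hlines, hct, hsubs⟩ := hst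
  rcases hπ k hk with hmem | ⟨r, hr, σ, hc, hp⟩
  · exact absurd hmem (Set.notMem_empty _)
  obtain ⟨i, hi, hri⟩ := List.getElem_of_mem hr
  set S := proofSize π with hS
  have hψmem : π[k] ∈ π := List.getElem_mem hk
  -- the substitution for the three metavariables, unused ones sent to `⊤`
  let σ' : ℕ → PropForm (List Bool) := fun j =>
    if j ∈ allVars r then (σ j).mapVars encodeNat else .const true
  let it : Item := (tag (6 + i), scode (σ' 0), scode (σ' 1), scode (σ' 2))
  -- string instances of the rule formulas are codes of the formula instances
  have hfill : ∀ p ∈ r.conclusion :: r.premises,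
      sfill (sv (scode (σ' 0)) (scode (σ' 1)) (scode (σ' 2))) p = lcode (p.subst σ) := by
    intro p hpmem
    have h1 : sfill (sv (scode (σ' 0)) (scode (σ' 1)) (scode (σ' 2))) p = scode (substL σ' p) :=
      sfill_eq_scode p fun j hj =>
        sv_lt_three _ _ _ (vars_lt_three_of_mem_rules hr p hpmem j hj) (fun j => scode (σ' j)) rfl rfl rfl
    rw [h1, lcode, mapVars_subst]
    congr 1
    refine substL_congr p fun j hj => ?_
    have hjall : j ∈ allVars r := List.mem_flatMap.2 ⟨p, hpmem, hj⟩
    simp [σ', hjall]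
  -- the three substituted strings are certified after the pool items of line `k`
  have hpool : ∀ j, scode (σ' j) ∈ extra (π[k].mapVars encodeNat) ++ st.pool := by
    intro j
    by_cases hj : j ∈ allVars r
    · have hσ' : σ' j = (σ j).mapVars encodeNat := by simp [σ', hj]
      rw [hσ']
      obtain ⟨p, hpmem, hjp⟩ := List.mem_flatMap.1 hj
      have hsub : σ j ∈ subs (p.subst σ) := apply_mem_subs_subst σ hjp
      have hsub' : (σ j).mapVars encodeNat ∈ subs ((p.subst σ).mapVars encodeNat) := by
        rw [subs_mapVars]; exact List.mem_map_of_mem hsub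
      rcases List.mem_cons.1 hpmem with rfl | hpmem
      · rw [hc] at hsub'
        exact List.mem_append_left _ (scode_mem_extra_of_mem_subs hsub')
      · obtain ⟨m, hm, hmeq⟩ := List.mem_take_iff_getElem.1 (hp p hpmem)
        rw [← hmeq] at hsub'
        exact List.mem_append_right _ (hsubs m (by omega) (by omega) _ hsub')
    · have hσ' : σ' j = .const true := by simp [σ', hj]
      rw [hσ']
      exact List.mem_append_right _ hct
  -- sizes and variables of the substituted formulas
  have hσsize : ∀ j, (scode (σ' j)).length ≤ (2 * B + 4) * (S + 1) := by
    intro j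
    by_cases hj : j ∈ allVars r
    · have hσ' : σ' j = (σ j).mapVars encodeNat := by simp [σ', hj]
      rw [hσ']
      obtain ⟨p, hpmem, hjp⟩ := List.mem_flatMap.1 hj
      have hsub : σ j ∈ subs (p.subst σ) := apply_mem_subs_subst σ hjp
      -- `p.subst σ` is a line of `π`
      have hline : p.subst σ ∈ π := by
        rcases List.mem_cons.1 hpmem with rfl | hpmem
        · rw [hc]; exact hψmem
        · exact List.mem_of_mem_take (hp p hpmem)
      refine (length_scode_mapVars_le ((size_le_of_mem_subs hsub).trans (size_le_proofSize hline))
        fun v hv => hB _ hline v (varList_subset_of_mem_subs hsub hv)).trans ?_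
      exact Nat.mul_le_mul_left _ (Nat.le_succ _)
    · have hσ' : σ' j = .const true := by simp [σ', hj]
      rw [hσ']
      simp only [scode, List.length_cons, List.length_nil]
      nlinarith
  refine ⟨poolItems (π[k].mapVars encodeNat) ++ [it], ?_, ?_⟩
  · rw [run_append, run_poolItems]
    simp only [run, it]
    rw [stepModel_rule hi]
    simp only [hri]
    refine ⟨?_, ?_, List.mem_append_right _ hct, ?_⟩
    · -- the checks pass
      simp only [hok, Bool.true_and, ruleOk, Bool.and_eq_true, List.all_eq_true, decide_eq_true_eq]
      refine ⟨fun p hpmem => ?_, ?_, ?_, ?_⟩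
      · rw [hfill p (List.mem_cons_of_mem _ hpmem), hlines, List.mem_reverse]
        exact List.mem_map_of_mem (hp p hpmem)
      · exact hpool 0
      · exact hpool 1
      · exact hpool 2
    · -- the new line
      rw [hfill _ (by simp), hc, hlines, List.take_succ_eq_append_getElem hk, List.map_append,
        List.reverse_append]
      rfl
    · -- subformulas of the first `k + 1` lines are certified
      intro m hm hmk sub hsub
      rcases Nat.lt_succ_iff_lt_or_eq.1 hmk with hmk | rfl
      · exact List.mem_append_right _ (hsubs m hm hmk sub hsub)
      · exact List.mem_append_left _ (scode_mem_extra_of_mem_subs hsub)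
  · -- the bit count
    rw [certBits_append, certBits_singleton]
    have hBk : ∀ bs ∈ (π[k].mapVars encodeNat).varList, bs.length ≤ B := by
      intro bs hbs
      rw [PropForm.varList_mapVars] at hbs
      obtain ⟨v, hv, rfl⟩ := List.mem_map.1 hbs
      exact hB _ hψmem v hv
    have h1 := certBits_poolItems_le _ hBk
    rw [PropForm.size_mapVars] at h1
    have hsz : π[k].size ≤ S := size_le_proofSize hψmem
    have h2 : itemBits it ≤ 12 * (2 * B + 4) * (S + 1) + 78 := by
      have h0 := hσsize 0
      have h1 := hσsize 1
      have h2 := hσsize 2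
      simp only [itemBits, it, tag, List.length_replicate]
      rw [length_rules] at hi
      nlinarith
    have h3 : π[k].size * (8 * (2 * B + 4) * π[k].size + 42) ≤
        π[k].size * (8 * (2 * B + 4) * S + 42) :=
      Nat.mul_le_mul_left _ (by nlinarith)
    omega

/-- The bits of one line, uniformly: at most `20 (S+1) ((2B+4)(S+1) + 6)`. [folklore] -/
theorem lineBits_le (m B S : ℕ) (hm : m ≤ S) :
    m * (8 * (2 * B + 4) * S + 42) + (12 * (2 * B + 4) * (S + 1) + 78) ≤
      20 * (S + 1) * ((2 * B + 4) * (S + 1) + 6) := by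
  set W := (2 * B + 4) * (S + 1) with hW
  have hA : (2 * B + 4) * S ≤ W := Nat.mul_le_mul_left _ (Nat.le_succ S)
  have h1 : m * (8 * (2 * B + 4) * S + 42) ≤ (S + 1) * (8 * W + 42) :=
    Nat.mul_le_mul (by omega) (by rw [Nat.mul_assoc]; omega)
  have h2 : (S + 1) * (8 * W + 42) = 8 * ((S + 1) * W) + 42 * (S + 1) := by ring
  have h3 : 20 * (S + 1) * (W + 6) = 20 * ((S + 1) * W) + 120 * (S + 1) := by ring
  have h4 : 12 * (2 * B + 4) * (S + 1) = 12 * W := by rw [hW]; ring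
  have hWX : W ≤ (S + 1) * W := Nat.le_mul_of_pos_left W (Nat.succ_pos S)
  rw [h3, h4]
  omega

/-- **All lines.** For a `textbookFrege`-derivation `π` from no hypotheses with variable
indices of binary length `≤ B`, there are items establishing the invariant for all of `π`,
of bit length at most `26 + |π| · 20 (S+1) ((2B+4)(S+1) + 6)`. [cite: CookReckhow1979, §1 (closing remark) and §2 Def. 2.1] -/
theorem exists_good {π : List (PropForm ℕ)} (hπ : textbookFrege.IsDerivation ∅ π) {B : ℕ}
    (hB : ∀ ψ ∈ π, ∀ v ∈ ψ.varList, (encodeNat v).length ≤ B) :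
    ∀ k ≤ π.length, ∃ items : List Item, Good π k (run items init) ∧
      certBits items ≤ 26 + k * (20 * (proofSize π + 1) * ((2 * B + 4) * (proofSize π + 1) + 6)) := by
  intro k
  induction k with
  | zero =>
    intro _
    refine ⟨[(tag 1, [], [], [])], ⟨?_, ?_, ?_, ?_⟩, ?_⟩
    · simp [run, stepModel_tag (show 1 < numKinds by decide), applyKind, poolOk, init]
    · simp [run, stepModel_tag (show 1 < numKinds by decide), applyKind, init]
    · simp [run, stepModel_tag (show 1 < numKinds by decide), applyKind, poolOut, init]
    · intro m _ hm; omega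
    · simp [itemBits, tag]
  | succ k ih =>
    intro hk
    obtain ⟨items, hgood, hbits⟩ := ih (by omega)
    obtain ⟨its, hgood', hbits'⟩ := good_succ hπ hB (show k < π.length by omega) hgood
    refine ⟨items ++ its, by rwa [run_append], ?_⟩
    rw [certBits_append]
    have hline := lineBits_le (π[k].size) B (proofSize π) (size_le_proofSize (List.getElem_mem _))
    rw [Nat.succ_mul]
    omega

/-! ### Normalising the variables of a proof (Cook–Reckhow Lemma 2.5) -/

/-- A substitution fixing the variables of `ψ` fixes `ψ`. [folklore] -/
theorem subst_eq_self {τ : ℕ → PropForm ℕ} {ψ : PropForm ℕ}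
    (h : ∀ v ∈ ψ.varList, τ v = .var v) : ψ.subst τ = ψ := by
  induction ψ with
  | var v => simpa [PropForm.subst, PropForm.varList] using h
  | const b => rfl
  | neg ψ ih => simp [PropForm.subst, ih (fun v hv => h v (by simpa [PropForm.varList] using hv))]
  | conj ψ χ ih₁ ih₂ =>
    simp [PropForm.subst, ih₁ (fun v hv => h v (by simp [PropForm.varList, hv])),
      ih₂ (fun v hv => h v (by simp [PropForm.varList, hv]))]
  | disj ψ χ ih₁ ih₂ =>
    simp [PropForm.subst, ih₁ (fun v hv => h v (by simp [PropForm.varList, hv])),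
      ih₂ (fun v hv => h v (by simp [PropForm.varList, hv]))]

/-- The variables of an instance come from the substituted formulas. [folklore] -/
theorem mem_varList_subst {τ : ℕ → PropForm ℕ} {ψ : PropForm ℕ} {v : ℕ}
    (h : v ∈ (ψ.subst τ).varList) : ∃ x ∈ ψ.varList, v ∈ (τ x).varList := by
  induction ψ with
  | var x => exact ⟨x, by simp [PropForm.varList], h⟩
  | const b => simp [PropForm.subst, PropForm.varList] at h
  | neg ψ ih => simpa [PropForm.varList] using ih (by simpa [PropForm.subst, PropForm.varList] using h)
  | conj ψ χ ih₁ ih₂ =>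
    simp only [PropForm.subst, PropForm.varList, List.mem_append] at h
    rcases h with h | h
    · obtain ⟨x, hx, hv⟩ := ih₁ h; exact ⟨x, by simp [PropForm.varList, hx], hv⟩
    · obtain ⟨x, hx, hv⟩ := ih₂ h; exact ⟨x, by simp [PropForm.varList, hx], hv⟩
  | disj ψ χ ih₁ ih₂ =>
    simp only [PropForm.subst, PropForm.varList, List.mem_append] at h
    rcases h with h | h
    · obtain ⟨x, hx, hv⟩ := ih₁ h; exact ⟨x, by simp [PropForm.varList, hx], hv⟩
    · obtain ⟨x, hx, hv⟩ := ih₂ h; exact ⟨x, by simp [PropForm.varList, hx], hv⟩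

/-- **Normalisation of the variables of a proof** (Cook–Reckhow 1979, Lemma 2.5, in the tree
`FregeSystem.IsProofOf.map_subst`): substituting `⊤` for the variables not occurring in `φ`
turns a `textbookFrege`-proof of `φ` into one of no larger size all of whose variables occur
in `φ`. [cite: CookReckhow1979, Lemma 2.5] -/
theorem exists_normalized {π : List (PropForm ℕ)} {φ : PropForm ℕ} (h : textbookFrege.IsProofOf π φ) :
    ∃ π' : List (PropForm ℕ), textbookFrege.IsProofOf π' φ ∧ proofSize π' ≤ proofSize π ∧
      ∀ ψ ∈ π', ∀ v ∈ ψ.varList, v ∈ φ.varList := by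
  classical
  let τ : ℕ → PropForm ℕ := fun v => if v ∈ φ.varList then .var v else .const true
  have hφ : φ.subst τ = φ := subst_eq_self fun v hv => by simp [τ, hv]
  refine ⟨π.map (PropForm.subst τ), by simpa [hφ] using h.map_subst τ, ?_, ?_⟩
  · simp only [proofSize, List.map_map]
    refine List.sum_le_sum fun ψ _ => ?_
    simpa using PropForm.size_subst_le (τ := τ) (M := 1) le_rfl (fun x => by
      simp only [τ]; split_ifs <;> simp [PropForm.size]) ψ
  · intro ψ hψ v hv
    obtain ⟨χ, -, rfl⟩ := List.mem_map.1 hψ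
    obtain ⟨x, -, hx⟩ := mem_varList_subst hv
    by_cases hxφ : x ∈ φ.varList
    · simp only [τ, hxφ, if_true, PropForm.varList, List.mem_singleton] at hx
      rwa [hx]
    · simp [τ, hxφ, PropForm.varList] at hx

/-- The binary length of a variable index of `φ` is at most the length of the codeword of `φ`
(`PropForm.sum_varList_le_length_code`). [folklore] -/
theorem length_encodeNat_le_of_mem_varList {φ : PropForm ℕ} {v : ℕ} (hv : v ∈ φ.varList) :
    (encodeNat v).length ≤ (encodingPropForm.encode φ).length := by
  have h1 : 2 * (encodeNat v).length + 3 ≤ (φ.varList.map fun n => 2 * (encodeNat n).length + 3).sum :=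
    List.le_sum_of_mem (List.mem_map_of_mem hv)
  have h2 := PropForm.sum_varList_le_length_code φ
  have h3 : φ.code.length ≤ (encodingPropForm.encode φ).length := by
    change φ.code.length ≤ (boolPair (unaryEncodeNat φ.size) φ.code).length
    rw [length_boolPair]; omega
  omega

/-! ### Completeness of the model -/

/-- **Completeness of the checker (model level).** Every `textbookFrege`-proof `π` of `φ`
yields a list of items on which the checker, run from the initial state, ends with verdict
`true` and with `φ.code` as its most recent line, and whose certificate has at most
`100 (proofSize π + |code φ| + 2)^4` bits. [cite: CookReckhow1979, §1 (closing remark) and §2 Def. 2.1, Lemma 2.5] -/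
theorem exists_certificate {π : List (PropForm ℕ)} {φ : PropForm ℕ} (h : textbookFrege.IsProofOf π φ) :
    ∃ items : List Item, (run items init).ok = true ∧
      (run items init).lines.head? = some φ.code ∧
      certBits items ≤ 100 * (proofSize π + (encodingPropForm.encode φ).length + 2) ^ 4 := by
  obtain ⟨π', hπ', hsize, hvars⟩ := exists_normalized h
  set N := (encodingPropForm.encode φ).length with hN
  have hB : ∀ ψ ∈ π', ∀ v ∈ ψ.varList, (encodeNat v).length ≤ N := fun ψ hψ v hv =>
    length_encodeNat_le_of_mem_varList (hvars ψ hψ v hv)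
  obtain ⟨items, hgood, hbits⟩ := exists_good hπ'.1 hB π'.length le_rfl
  refine ⟨items, hgood.ok, ?_, ?_⟩
  · rw [hgood.lines, List.take_length, List.head?_reverse, List.getLast?_map, hπ'.2]
    simp [lcode, code_eq_scode]
  · -- arithmetic: `26 + L · 20 (S'+1)((2N+4)(S'+1)+6) ≤ 100 (S + N + 2)^4`
    have hL : π'.length ≤ proofSize π' := length_le_proofSize π'
    set S' := proofSize π' with hS'
    set S := proofSize π with hS
    set t := S + N + 2 with ht
    have hS't : S' + 1 ≤ t := by omega
    have hNt : 2 * N + 4 ≤ 2 * t := by omega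
    have h1 : π'.length * (20 * (S' + 1) * ((2 * N + 4) * (S' + 1) + 6)) ≤
        t * (20 * t * (2 * t * t + 6)) :=
      Nat.mul_le_mul (by omega) (Nat.mul_le_mul (by omega) (by nlinarith))
    have h2 : 26 + t * (20 * t * (2 * t * t + 6)) ≤ 100 * t ^ 4 := by
      have ht2 : 2 ≤ t := by omega
      have : t ^ 4 = t * t * t * t := by ring
      rw [this]
      nlinarith [Nat.mul_le_mul ht2 ht2, mul_pos (by omega : 0 < t) (by omega : 0 < t)]
    omega

end FregeVerifier

end Literature.Computability.MetaComplexity
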